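import Literature.AlgebraicGeometry.Resolution.CurveCentreNearPointGammaPrimeQuotient
import Literature.AlgebraicGeometry.Resolution.DehomogenizedFormIntegral
import Literature.AlgebraicGeometry.Resolution.NearPointsRational
import Literature.AlgebraicGeometry.Resolution.PointBlowupOrder
import Literature.AlgebraicGeometry.Resolution.HypersurfaceTransform
import Literature.AlgebraicGeometry.Resolution.StalkIdealLemmas
import Literature.AlgebraicGeometry.Resolution.RegularLocalRingsNormal
import Literature.AlgebraicGeometry.Resolution.BlowupChartQuasiRegular
import Literature.AlgebraicGeometry.Resolution.StalkSpecializesLocalization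
import Literature.AlgebraicGeometry.Resolution.BlowupRelativeDimension
import HarnessLib

/-!
# [CoP1] Lemma 4.3 (4), the curve `Γ′` over a curve centre is REGULAR — proof of the F-71 stub T2b′
# (`stub_T2b'_isRegular_gammaPrime`): the pair `(π♯c_j, t − π♯a)` inside `𝔭_{η′}`

Topic: `Literature/AlgebraicGeometry/Resolution`. [CoP1] = Cossart–Piltant, J. Algebra 320 (2008), Lemma 4.3 (4) [p. 9 L42–43]:
"If `Γ′` is the one-dimensional component of `Σ′ ∩ q⁻¹(Y)`, then `Γ′` is either empty or a regular irreducible curve projecting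
isomorphically to `Y` by `q`", with the proof's coordinates [p. 10 L11–12] «`x′ := (y₁′ = y₁, y₂′ = y₂/y₁, y₃)`».  Third file of the
series `CurveCentreNearPointGammaPrime` (clauses 2–3 + reduction to the quotient stalks) / `CurveCentreNearPointGammaPrimeQuotient`
(quotient step: an rsop pair inside `𝔭_{η′}` suffices); here the pair is produced and the stub is assembled:

* `IsBlowup.exists_isRsopPart_le_primeOfSpecializes_of_isNear_curve` — at a point `z` of `Γ′ = cl{η′}` (`η′` near over the generic
  point `η` of the regular irreducible codimension-`2` centre `Y`), with `c` an ADAPTED rsop pair cutting out `Y` at `x = π z`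
  (p613580's shear) and `t = c_l/c_j` the chart parameter of the regular system `(π♯c_j, t, π♯w)` at the near point `z` (p616045),
  the weak transform `F(1, t)` of the adapted form `F(c) ∈ J_x` lies in `J′_z` (chart colon computation of `NearPointsRational`), hence —
  pushed to `η′` along `stalkSpecializes`, where `J′_{η′} ⊆ 𝔪_{η′}` because `η′` is near — in `𝔭_{η′}`; reading this in the residue
  field `κ(η′)` makes the value `t̄` INTEGRAL over `S = 𝒪_{X,x}/𝔭_η = 𝒪_{Y,x}` (unit `Y_l^μ`-coefficient;
  `isIntegral_of_eval₂_dehomogenize_eq_zero`); `t̄` is a FRACTION over `S` because `κ(η) → κ(η′)` is onto (rationality of near points,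
  p613580's `IsBlowup.residue_comp_stalkMap_surjective_of_isNear`, and `𝒪_{X,η} = S_{(0)}`-type localisation
  `isLocalizationAtPrime_stalkSpecializes`); `S` is regular hence normal, so `t̄ = ā` for some `a ∈ 𝒪_{X,x}`
  (`exists_algebraMap_eq_of_isIntegral_of_mul_eq`), i.e. `t − π♯a ∈ 𝔭_{η′}`; necessarily `a ∈ 𝔪_x`, and `(π♯c_j, t − π♯a)` is part
  of the regular system `(π♯c_j, t − π♯a, π♯w)` of `𝒪_{X′,z}`;
* `IsBlowup.isRegular_gammaPrime_of_isNear_curve` — **the stub, binders and conclusion verbatim**: `Γ′` (reduced) is regular, all its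
  points are near, `π(Γ′) = Y`.

Fact-free, def-free; general dimension (no threefold hypothesis is needed).  [OURS plumbing for cell res-hironaka W4.5a crux F-71
(`CossartPiltant2008_prop44` is NOT discharged by this brick); prover res-inputs-p-6.]  NOT a statement of any manuscript under
review (Hironaka 2017).  AI-written; weaker than expert review.

## Sources
* V. Cossart, O. Piltant, J. Algebra 320 (2008), Lemma 4.3 (4) [p. 9 L42–43], proof of Prop. 4.4 [p. 10 L11–12]. [CossartPiltant2008]
-/

noncomputable section

open CategoryTheory AlgebraicGeometry TopologicalSpace IsLocalRing

namespace Literature.AlgebraicGeometry.Resolution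

universe u

open Scheme.IdealSheafData

variable {X X' : Scheme.{u}} {π : X' ⟶ X}

set_option maxHeartbeats 800000 in
-- one long chart computation over the Rees chart ring of a stalk (as in p616045's `exists_chart_rsop_…`)
/-- **The pair `(π♯c_j, t − π♯a)` inside `𝔭_{η′}` at a point `z` of `Γ′ = cl{η′}`** ([CoP1] p. 10 L11–12 «x′ := (y₁′ = y₁,
y₂′ = y₂/y₁, y₃)»).  `X` regular locally Noetherian, `π` the blowing up of the regular irreducible codimension-`2` centre
`Y = cl{π η′} ⊆ {ord J = μ}` (`μ ≥ 1`), `η′` near, `η′ ⤳ z`.  Then `𝔭_{η′} ⊂ 𝒪_{X′,z}` contains a pair that is part of a regular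
system of parameters of `𝒪_{X′,z}`: with `c` an adapted rsop pair cutting out `Y` at `x = π z` and `t = c_l/c_j` the chart
parameter at the near point `z` (p616045), the weak transform `F(1, t)` of the adapted form `F(c) ∈ J_x` lies in `J′_z`, hence
(`J′_{η′} ⊆ 𝔪_{η′}`, `η′` near) in `𝔭_{η′}`; so the value `t̄ ∈ κ(η′)` of `t` is integral over `𝒪_{Y,x} = 𝒪_{X,x}/𝓘_{Y,x}`
(unit top coefficient), and it is a fraction over `𝒪_{Y,x}` because `κ(π η′) → κ(η′)` is onto (rationality of near points,
p613580); `𝒪_{Y,x}` is regular, hence normal, so `t̄` is the class of some `a ∈ 𝒪_{X,x}`, `t − π♯a ∈ 𝔭_{η′}`, and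
`(π♯c_j, t − π♯a)` is part of the regular system `(π♯c_j, t, π♯w)` up to the unit change `a ∈ 𝔪_x`.
[cite: CossartPiltant2008, Lemma 4.3 (4) (proof of Prop. 4.4, p. 10 L11–12)] -/
theorem IsBlowup.exists_isRsopPart_le_primeOfSpecializes_of_isNear_curve [IsLocallyNoetherian X]
    [IsLocallyNoetherian X'] (hX : Scheme.IsRegular X) {Y : Closeds X}
    (hreg : Scheme.IsRegular (vanishingIdeal Y).subscheme) (hπ : IsBlowup π (vanishingIdeal Y))
    {J : X.IdealSheafData} {μ : ℕ} (hμ : 1 ≤ μ) (hY : ∀ y ∈ (Y : Set X), idealOrder J y = μ)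
    {η' : X'} (hη' : closure {π η'} = (Y : Set X)) (hcodim : Order.coheight (π η') = 2)
    (hnear : IsNear π (vanishingIdeal Y) J μ η') {z : X'} (hz : η' ⤳ z) :
    ∃ v : Fin 2 → X'.presheaf.stalk z, IsRsopPart v ∧
      Ideal.span (Set.range v) ≤ primeOfSpecializes hz := by
  classical
  -- regularity of the stalks involved
  have hx : π η' ⤳ π z := hz.map π.continuous
  haveI hRx : IsRegularLocalRing (X.presheaf.stalk (π z)) := hX _
  haveI hRη : IsRegularLocalRing (X.presheaf.stalk (π η')) := hX _
  have hX' : Scheme.IsRegular X' := hπ.isRegular_of_isRegular_subscheme hX hreg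
  haveI : IsRegularLocalRing (X'.presheaf.stalk z) := hX' z
  haveI : IsRegularLocalRing (X'.presheaf.stalk η') := hX' η'
  -- `Y = cl{η}`, `x ∈ Y`, `𝓘_{Y,x} = 𝔭_η`
  have hYc : Y = ⟨closure {π η'}, isClosed_closure⟩ := Closeds.ext hη'.symm
  have hη'Y : π η' ∈ (Y : Set X) := hη' ▸ subset_closure rfl
  have hxY : π z ∈ (Y : Set X) := hx.mem_closed Y.isClosed hη'Y
  have hxC : π z ∈ (vanishingIdeal Y).support := by rw [← SetLike.mem_coe, coe_support_vanishingIdeal]; exact hxY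
  have hP𝔭 : stalkIdeal (vanishingIdeal Y) (π z) = primeOfSpecializes hx := hYc ▸ stalkIdeal_vanishingIdeal_closure hx
  -- an rsop pair `c` at `x` cutting out `Y`
  obtain ⟨r, c, hcr, hcY⟩ := exists_isRsopPart_span_range_eq_stalkIdeal_of_mem_closeds hreg hxY
  obtain rfl : r = 2 := by
    have h1 := hcr.height_span_range
    rw [hcY, hP𝔭] at h1
    have h2 := coe_height_primeOfSpecializes hx
    rw [h1, hcodim] at h2
    exact_mod_cast h2
  -- `z` is near
  have hnz : IsNear π (vanishingIdeal Y) J μ z :=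
    hπ.isNear_of_specializes_of_isNear_curve hX hreg hY hη'Y hz hnear
  -- STEP 1: shear `c` to an ADAPTED pair at `x` (as in p616045's coordinate-free theorem)
  have hcm : ∀ i, c i ∈ maximalIdeal _ := hcr.mem_maximalIdeal
  have hcq : IsQuasiRegular c := by
    obtain ⟨e, zz, hd, hzz, hzzc⟩ := hcr.exists_rsop
    have h := isQuasiRegular_rsop_comp hd zz hzz (Fin.castAdd e) (Fin.castAdd_injective 2 e)
    rwa [show zz ∘ Fin.castAdd e = c from funext hzzc] at h
  obtain ⟨j, 𝔴₀, χ₀, hχ₀, hloc₀, h𝔴₀⟩ := hπ.exists_reesChart_stalk z c hcY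
  have h𝔴₀' : (maximalIdeal _).map (chartBase c j) ≤ 𝔴₀.asIdeal := by rw [← h𝔴₀]; exact Ideal.map_comap_le
  obtain ⟨l, hl⟩ : ∃ l : Fin 2, l ≠ j := ⟨j + 1, by fin_cases j <;> decide⟩
  have hnearF : ∀ F : MvPolynomial (Fin 2) (X.presheaf.stalk (π z)), F.IsHomogeneous μ →
      MvPolynomial.eval c F ∈ stalkIdeal J (π z) →
      (algebraMap (chartRing c j) (Localization.AtPrime 𝔴₀.asIdeal) :
          chartRing c j →+* Localization.AtPrime 𝔴₀.asIdeal)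
          (MvPolynomial.eval₂Hom (chartBase c j) (fun i => chartGen c j i) F) ∈
        maximalIdeal (Localization.AtPrime 𝔴₀.asIdeal) ^ μ :=
    fun F hF hFJ => algebraMap_eval₂Hom_mem_pow_of_isNear hcY j 𝔴₀ χ₀ hχ₀ hloc₀ hnz hF hFJ
  obtain ⟨a₀, ha₀⟩ :=
    exists_forall_mem_initialForms_eq_C_mul_pow c j hl hcq hcm 𝔴₀.asIdeal h𝔴₀' hμ hnearF
  obtain ⟨ã₀, hã₀⟩ := residue_surjective (R := X.presheaf.stalk (π z)) a₀
  have ha₀' : ∀ G ∈ initialForms c (stalkIdeal J (π z)) μ, ∃ c₀ : ResidueField _,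
      G = MvPolynomial.C c₀ * (MvPolynomial.X l -
        MvPolynomial.C (residue _ ã₀) * MvPolynomial.X j) ^ μ := by
    rw [hã₀]; exact ha₀
  have hadapt := initialForms_shiftRsop_adapted c j hl ã₀ ha₀'
  obtain ⟨c₂, hc₂⟩ : ∃ c₂ : Fin 2 → X.presheaf.stalk (π z), c₂ = shiftRsop c j fun _ => ã₀ := ⟨_, rfl⟩
  have hcr₂ : IsRsopPart c₂ := hc₂ ▸ hcr.shiftRsop j ã₀
  have hcY₂ : Ideal.span (Set.range c₂) = stalkIdeal (vanishingIdeal Y) (π z) := by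
    rw [hc₂, span_range_shiftRsop, hcY]
  replace hadapt : ∀ G ∈ initialForms c₂ (stalkIdeal J (π z)) μ,
      ∃ c₀ : ResidueField (X.presheaf.stalk (π z)), G = MvPolynomial.C c₀ * MvPolynomial.X l ^ μ := by
    rw [hc₂]; exact hadapt
  have hcm₂ : ∀ i, c₂ i ∈ maximalIdeal _ := hcr₂.mem_maximalIdeal
  -- STEP 2: complete `c₂` to a regular system of parameters `(c₂, w)` of `𝒪_{X,x}`
  obtain ⟨e, zz, hd, hzz, hzzc⟩ := hcr₂.exists_rsop
  obtain ⟨w, hw⟩ : ∃ w : Fin e → X.presheaf.stalk (π z), w = fun k => zz (Fin.natAdd 2 k) := ⟨_, rfl⟩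
  have happ : Fin.append c₂ w = zz := by
    funext i
    induction i using Fin.addCases with
    | left i => rw [Fin.append_left, hzzc]
    | right k => rw [Fin.append_right, hw]
  have hzspan : Ideal.span (Set.range (Fin.append c₂ w)) = maximalIdeal _ := by rw [happ]; exact hzz
  -- STEP 3: the chart at the near point `z`: rsop `(π♯c₂_j, t, π♯w)` with `π♯c₂_l = π♯c₂_j · t`
  obtain ⟨𝔴, χ, hχ, hloc, h𝔴, he, -, hdim', hspan', hmul⟩ :=
    hπ.exists_chart_rsop_of_isNear_curve_of_adapted hX hreg hμ hY hcr₂ hcY₂ j hl hadapt hnz w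
      hzspan hd
  obtain ⟨t, ht⟩ : ∃ t : X'.presheaf.stalk z, t = χ (chartGen c₂ j l) := ⟨_, rfl⟩
  rw [← ht] at hmul
  -- STEP 4: the adapted form `F` (degree `μ`, `F(c₂) ∈ J_x`, `F̄ = c₀ Y_l^μ`, unit `Y_l^μ`-coefficient)
  have hJP : stalkIdeal J (π z) ≤ Ideal.span (Set.range c₂) ^ μ := by
    rw [hcY₂, ← stalkIdeal_pow]
    exact stalkIdeal_mono (le_vanishingIdeal_pow_of_forall_idealOrder_eq hX hreg hY) _
  have hJnot : ¬ stalkIdeal J (π z) ≤ maximalIdeal _ ^ (μ + 1) := by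
    rw [← le_idealOrder_iff, hY (π z) hxY]
    exact_mod_cast Nat.not_succ_le_self μ
  obtain ⟨f, hfJ, hf'⟩ := Set.not_subset.mp hJnot
  obtain ⟨F, hF, hFf⟩ := exists_isHomogeneous_of_mem_span_pow c₂ μ (hJP hfJ)
  have hF0 : MvPolynomial.map (residue _) F ≠ 0 :=
    map_residue_ne_zero_of_eval_not_mem_pow_succ c₂ hcm₂ hF (by rw [hFf]; exact hf')
  have hFJ : MvPolynomial.eval c₂ F ∈ stalkIdeal J (π z) := by rw [hFf]; exact hfJ
  have hGmem : MvPolynomial.map (residue _) F ∈ initialForms c₂ (stalkIdeal J (π z)) μ :=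
    (mem_initialForms_iff c₂).mpr ⟨F, hF, hFJ, rfl⟩
  obtain ⟨c₀, hc₀⟩ := hadapt _ hGmem
  have hunit : IsUnit (F.coeff (Finsupp.single l μ)) := by
    have hc₀ne : c₀ ≠ 0 := by
      rintro rfl; apply hF0; rw [hc₀, MvPolynomial.C_0, zero_mul]
    have hcoef : residue _ (F.coeff (Finsupp.single l μ)) = c₀ := by
      have h := congrArg (MvPolynomial.coeff (Finsupp.single l μ)) hc₀
      rw [MvPolynomial.coeff_map, MvPolynomial.X_pow_eq_monomial, MvPolynomial.C_mul_monomial, mul_one,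
        MvPolynomial.coeff_monomial, if_pos rfl] at h
      exact h
    by_contra hnu
    apply hc₀ne
    rw [← hcoef, IsLocalRing.residue_eq_zero_iff]
    exact (IsLocalRing.mem_maximalIdeal _).mpr hnu
  -- STEP 5: the weak transform `g = χ(F(e))` of `F(c₂)` lies in `J′_z`, hence in `𝔭_{η′}`
  have hff' := reesChartBase_eval_eq_pow_mul_eval₂ c₂ j hF
  have hu : ∀ i, (π.stalkMap z).hom (c₂ i) = (π.stalkMap z).hom (c₂ j) * χ (chartGen c₂ j i) :=
    fun i => by rw [← hχ, ← hχ, ← map_mul, ← reesChartBase_apply_eq_mul_chartGen c₂ j i]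
  have hCmap : (stalkIdeal (vanishingIdeal Y) (π z)).map (π.stalkMap z).hom =
      Ideal.span {χ (chartBase c₂ j (c₂ j))} := by
    rw [← hcY₂, Ideal.map_span_range_eq_span_singleton _ c₂ j _ hu, ← hχ]
  have hmem : χ (MvPolynomial.eval₂Hom (chartBase c₂ j) (fun i => chartGen c₂ j i) F) ∈
      stalkIdeal (controlledTransform π (vanishingIdeal Y) J μ) z := by
    rw [controlledTransform, stalkIdeal_colon, stalkIdeal_pow, stalkIdeal_comap_eq_map_stalkMap,
      stalkIdeal_comap_eq_map_stalkMap, hCmap]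
    exact map_mem_colon_of_eq_pow_mul (chartBase c₂ j) χ (π.stalkMap z).hom hχ hff' hFJ
  have hgP : χ (MvPolynomial.eval₂Hom (chartBase c₂ j) (fun i => chartGen c₂ j i) F) ∈
      primeOfSpecializes hz := by
    have h1 : (X'.presheaf.stalkSpecializes hz).hom
        (χ (MvPolynomial.eval₂Hom (chartBase c₂ j) (fun i => chartGen c₂ j i) F)) ∈
        stalkIdeal (controlledTransform π (vanishingIdeal Y) J μ) η' := by
      rw [← stalkIdeal_map_stalkSpecializes _ hz]
      exact Ideal.mem_map_of_mem _ hmem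
    have h2 : stalkIdeal (controlledTransform π (vanishingIdeal Y) J μ) η' ≤ maximalIdeal _ :=
      ((le_idealOrder_iff _ η' μ).mp (isNear_iff.mp hnear).ge).trans (Ideal.pow_le_self (by omega))
    exact Ideal.mem_comap.mpr (h2 h1)
  -- STEP 6: the residue field `K = κ(η′)` as an algebra over `S = 𝒪_{X,x}/𝔭_η`
  obtain ⟨ψK, hψKdef⟩ : ∃ ψK : X'.presheaf.stalk z →+* ResidueField (X'.presheaf.stalk η'),
      ψK = (residue _).comp (X'.presheaf.stalkSpecializes hz).hom := ⟨_, rfl⟩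
  have hψK : ∀ r, ψK r = 0 ↔ r ∈ primeOfSpecializes hz := fun r => by
    rw [hψKdef, RingHom.comp_apply, IsLocalRing.residue_eq_zero_iff, Ideal.mem_comap]
  have hφP : ∀ a, (π.stalkMap z).hom a ∈ primeOfSpecializes hz ↔ a ∈ primeOfSpecializes hx :=
    fun a => by rw [← Ideal.mem_comap, comap_stalkMap_primeOfSpecializes π hz]
  haveI hp𝔭 : (primeOfSpecializes hx).IsPrime := Ideal.IsPrime.comap _
  haveI hSreg : IsRegularLocalRing (X.presheaf.stalk (π z) ⧸ primeOfSpecializes hx) := by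
    have h := isRegularLocalRing_stalk_quotient_stalkIdeal hreg hxC
    rwa [hP𝔭] at h
  haveI : IsDomain (X.presheaf.stalk (π z) ⧸ primeOfSpecializes hx) := isDomain_of_isRegularLocalRing _
  haveI : IsIntegrallyClosed (X.presheaf.stalk (π z) ⧸ primeOfSpecializes hx) :=
    isIntegrallyClosed_of_isRegularLocalRing _
  let σ : (X.presheaf.stalk (π z) ⧸ primeOfSpecializes hx) →+* ResidueField (X'.presheaf.stalk η') :=
    Ideal.Quotient.lift (primeOfSpecializes hx) (ψK.comp (π.stalkMap z).hom)
      (fun a ha => (hψK _).mpr ((hφP a).mpr ha))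
  letI := σ.toAlgebra
  have hσq : ∀ a, algebraMap (X.presheaf.stalk (π z) ⧸ primeOfSpecializes hx)
      (ResidueField (X'.presheaf.stalk η')) (Ideal.Quotient.mk _ a) = ψK ((π.stalkMap z).hom a) :=
    fun a => Ideal.Quotient.lift_mk _ _ _
  haveI : FaithfulSMul (X.presheaf.stalk (π z) ⧸ primeOfSpecializes hx)
      (ResidueField (X'.presheaf.stalk η')) := by
    rw [faithfulSMul_iff_algebraMap_injective, injective_iff_map_eq_zero]
    intro q hq
    obtain ⟨a, rfl⟩ := Ideal.Quotient.mk_surjective q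
    rw [hσq, hψK, hφP] at hq
    exact Ideal.Quotient.eq_zero_iff_mem.mpr hq
  -- STEP 7: `t̄ = ψK t` is integral over `S` (root of the dehomogenised adapted form, unit top coefficient)
  haveI : Unique {i : Fin 2 // i ≠ j} := (finSuccAboveEquiv j).symm.unique
  have hroot : MvPolynomial.eval₂ (ψK.comp (π.stalkMap z).hom) (fun _ => ψK t) (dehomogenize j F) = 0 := by
    have h0 : ψK (χ (MvPolynomial.eval₂Hom (chartBase c₂ j) (fun i => chartGen c₂ j i) F)) = 0 :=
      (hψK _).mpr hgP
    have hk := RingHom.congr_fun (eval₂Hom_comp_aeval_kill c₂ j) F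
    have hdh : (MvPolynomial.aeval (fun j_1 : Fin 2 => if h : j_1 = j then
        (1 : MvPolynomial {i : Fin 2 // i ≠ j} (X.presheaf.stalk (π z))) else MvPolynomial.X ⟨j_1, h⟩)).toRingHom F =
        dehomogenize j F := rfl
    rw [RingHom.comp_apply, hdh] at hk
    rw [← hk, MvPolynomial.map_eval₂Hom, MvPolynomial.map_eval₂Hom] at h0
    have hring : ψK.comp (χ.comp (chartBase c₂ j)) = ψK.comp (π.stalkMap z).hom := by
      ext a
      simp only [RingHom.comp_apply, hχ]
    have hfun : (fun i : {i : Fin 2 // i ≠ j} => ψK (χ (chartGen c₂ j i.1))) = fun _ => ψK t := by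
      funext i
      have hi : i = ⟨l, hl⟩ := Subsingleton.elim _ _
      rw [hi, ht]
    rw [hring, hfun, MvPolynomial.coe_eval₂Hom] at h0
    exact h0
  have hint : IsIntegral (X.presheaf.stalk (π z) ⧸ primeOfSpecializes hx) (ψK t) :=
    isIntegral_of_eval₂_dehomogenize_eq_zero (ψK.comp (π.stalkMap z).hom) (Ideal.Quotient.mk _)
      (fun r => hσq r) hF hl hroot (hunit.map _)
  -- STEP 8: `t̄` is a fraction over `S`: `κ(η) → κ(η′)` is onto (rationality of the near point `η′`)
  obtain ⟨cη, hcηr, hcηY⟩ := exists_isRsopPart_fin_two_of_closure_eq hreg hη'.symm hcodim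
  have hsurj := hπ.residue_comp_stalkMap_surjective_of_isNear hX hreg hμ hY hcηr hcηY hnear
  obtain ⟨ρ, hρ⟩ := hsurj (ψK t)
  letI algx := (X.presheaf.stalkSpecializes hx).hom.toAlgebra
  haveI hlocx : IsLocalization.AtPrime (X.presheaf.stalk (π η')) (primeOfSpecializes hx) :=
    isLocalizationAtPrime_stalkSpecializes hx
  obtain ⟨⟨b, sden⟩, hbs⟩ := IsLocalization.surj (primeOfSpecializes hx).primeCompl ρ
  -- naturality of the specialization maps with `π`
  have hnat : ∀ a : X.presheaf.stalk (π z),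
      (π.stalkMap η').hom ((X.presheaf.stalkSpecializes hx).hom a) =
        (X'.presheaf.stalkSpecializes hz).hom ((π.stalkMap z).hom a) :=
    fun a => Scheme.Hom.stalkSpecializes_stalkMap_apply π η' z hz a
  have hκ : ∀ a : X.presheaf.stalk (π z),
      residue _ ((π.stalkMap η').hom (algebraMap (X.presheaf.stalk (π z)) (X.presheaf.stalk (π η')) a)) =
        ψK ((π.stalkMap z).hom a) := by
    intro a
    rw [RingHom.algebraMap_toAlgebra, hnat, hψKdef, RingHom.comp_apply]
  have key : algebraMap (X.presheaf.stalk (π z) ⧸ primeOfSpecializes hx) (ResidueField (X'.presheaf.stalk η'))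
        (Ideal.Quotient.mk _ (sden : X.presheaf.stalk (π z))) * ψK t =
      algebraMap (X.presheaf.stalk (π z) ⧸ primeOfSpecializes hx) (ResidueField (X'.presheaf.stalk η'))
        (Ideal.Quotient.mk _ b) := by
    have h := congrArg ((residue _).comp (π.stalkMap η').hom) hbs
    simp only [RingHom.comp_apply, map_mul] at h
    rw [hσq, hσq, ← hκ, ← hκ, ← h, ← RingHom.comp_apply (residue _) (π.stalkMap η').hom ρ, hρ, mul_comm]
  have hs0 : (Ideal.Quotient.mk (primeOfSpecializes hx) (sden : X.presheaf.stalk (π z))) ≠ 0 := by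
    rw [Ne, Ideal.Quotient.eq_zero_iff_mem]; exact sden.2
  obtain ⟨ā, hā⟩ := exists_algebraMap_eq_of_isIntegral_of_mul_eq hint hs0 key
  obtain ⟨a, rfl⟩ := Ideal.Quotient.mk_surjective ā
  rw [hσq] at hā
  -- STEP 9: `t − π♯a ∈ 𝔭_{η′}`, `a ∈ 𝔪_x`, and the pair `(π♯c₂_j, t − π♯a)`
  have htP : t - (π.stalkMap z).hom a ∈ primeOfSpecializes hz := by
    rw [← hψK, map_sub, hā, sub_self]
  have hPle : primeOfSpecializes hz ≤ maximalIdeal (X'.presheaf.stalk z) :=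
    IsLocalRing.le_maximalIdeal (Ideal.IsPrime.ne_top inferInstance)
  have htm : t ∈ maximalIdeal (X'.presheaf.stalk z) := by
    letI := χ.toAlgebra
    haveI : IsLocalization.AtPrime (X'.presheaf.stalk z) 𝔴.asIdeal := hloc
    rw [ht]
    exact (IsLocalization.AtPrime.to_map_mem_maximal_iff (X'.presheaf.stalk z) 𝔴.asIdeal _).mpr he
  have ham : a ∈ maximalIdeal (X.presheaf.stalk (π z)) := by
    by_contra hau
    have hua : IsUnit ((π.stalkMap z).hom a) := ((IsLocalRing.notMem_maximalIdeal.mp hau)).map _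
    have : t - (π.stalkMap z).hom a ∉ maximalIdeal (X'.presheaf.stalk z) := by
      intro hmem'
      have : (π.stalkMap z).hom a ∈ maximalIdeal (X'.presheaf.stalk z) := by
        have := Ideal.sub_mem _ htm hmem'
        rwa [sub_sub_cancel] at this
      exact (IsLocalRing.notMem_maximalIdeal.mpr hua) this
    exact this (hPle htP)
  -- `π♯a ∈ (π♯c₂_j, t − π♯a, π♯w)`-bookkeeping: `π♯a` lies in the ideal generated by `π♯c₂_j` and the `π♯w_k`
  have hφa : (π.stalkMap z).hom a ∈ Ideal.span ({(π.stalkMap z).hom (c₂ j)} ∪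
      Set.range fun k => (π.stalkMap z).hom (w k)) := by
    have ha' : (π.stalkMap z).hom a ∈ (maximalIdeal (X.presheaf.stalk (π z))).map (π.stalkMap z).hom :=
      Ideal.mem_map_of_mem _ ham
    rw [← hzspan, Ideal.map_span] at ha'
    refine (Ideal.span_le.mpr ?_) ha'
    rintro _ ⟨_, ⟨i, rfl⟩, rfl⟩
    induction i using Fin.addCases with
    | left i =>
      rw [Fin.append_left]
      by_cases hij : i = j
      · rw [hij]
        exact Ideal.subset_span (Or.inl rfl)
      · have hil : i = l := by
          have h1 : i.val ≠ j.val := fun h => hij (Fin.ext h)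
          have h2 : l.val ≠ j.val := fun h => hl (Fin.ext h)
          apply Fin.ext
          omega
        rw [hil, hmul]
        exact Ideal.mul_mem_right _ _ (Ideal.subset_span (Or.inl rfl))
    | right k =>
      rw [Fin.append_right]
      exact Ideal.subset_span (Or.inr ⟨k, rfl⟩)
  have hwm : ∀ k, w k ∈ maximalIdeal (X.presheaf.stalk (π z)) := fun k => by
    rw [← hzz, hw]
    exact Ideal.subset_span ⟨Fin.natAdd 2 k, rfl⟩
  -- the pair
  refine ⟨![(π.stalkMap z).hom (c₂ j), t - (π.stalkMap z).hom a], ?_, ?_⟩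
  · refine ⟨inferInstance, e, fun k => (π.stalkMap z).hom (w k), ?_, ?_⟩
    · -- `dim 𝒪_{X′,z} = 2 + e`
      have h := IsRegularLocalRing.spanFinrank_maximalIdeal (R := X'.presheaf.stalk z)
      rw [hdim'] at h
      exact_mod_cast h.symm
    · apply le_antisymm
      · rw [Ideal.span_le]
        rintro r (⟨i, rfl⟩ | ⟨k, rfl⟩)
        · fin_cases i
          · exact map_nonunit (π.stalkMap z).hom _ (hcm₂ j)
          · exact hPle htP
        · exact map_nonunit (π.stalkMap z).hom _ (hwm k)
      · -- `𝔪′ = (π♯c₂_j, t, π♯w) ⊆ (π♯c₂_j, t − π♯a, π♯w)`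
        have hsub : Ideal.span ({(π.stalkMap z).hom (c₂ j)} ∪ Set.range fun k => (π.stalkMap z).hom (w k)) ≤
            Ideal.span (Set.range ![(π.stalkMap z).hom (c₂ j), t - (π.stalkMap z).hom a] ∪
              Set.range fun k => (π.stalkMap z).hom (w k)) := by
          apply Ideal.span_mono
          rintro r (hr | hr)
          · exact Or.inl ⟨0, by rw [Set.mem_singleton_iff.mp hr]; rfl⟩
          · exact Or.inr hr
        have ht_mem : t ∈ Ideal.span (Set.range ![(π.stalkMap z).hom (c₂ j), t - (π.stalkMap z).hom a] ∪
            Set.range fun k => (π.stalkMap z).hom (w k)) := by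
          have h1 : t - (π.stalkMap z).hom a ∈ Ideal.span (Set.range ![(π.stalkMap z).hom (c₂ j),
              t - (π.stalkMap z).hom a] ∪ Set.range fun k => (π.stalkMap z).hom (w k)) :=
            Ideal.subset_span (Or.inl ⟨1, rfl⟩)
          have h2 := Ideal.add_mem _ h1 (hsub hφa)
          rwa [sub_add_cancel] at h2
        rw [← hspan', Ideal.span_le]
        rintro _ ⟨i, rfl⟩
        rw [SetLike.mem_coe]
        refine Fin.cases ?_ (fun i' => ?_) i
        · rw [chartFamily, Fin.cons_zero, RingHom.algebraMap_toAlgebra, hχ]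
          exact Ideal.subset_span (Or.inl ⟨0, rfl⟩)
        · rw [chartFamily, Fin.cons_succ]
          induction i' using Fin.addCases with
          | left k =>
            rw [Fin.append_left, RingHom.algebraMap_toAlgebra, ← ht]
            exact ht_mem
          | right k =>
            rw [Fin.append_right, RingHom.algebraMap_toAlgebra, hχ]
            exact Ideal.subset_span (Or.inr ⟨k, rfl⟩)
  · rw [Ideal.span_le]
    rintro _ ⟨i, rfl⟩
    fin_cases i
    · refine (hφP _).mpr ?_
      rw [← hP𝔭, ← hcY₂]
      exact Ideal.subset_span ⟨j, rfl⟩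
    · exact htP

/-- **[CoP1] Lemma 4.3 (4), the curve `Γ′` — the F-71 stub `stub_T2b'_isRegular_gammaPrime` PROVED** (binders and
conclusion verbatim): for the blowing up `π` of the regular locally Noetherian `X` along the regular irreducible
codimension-`2` centre `Y ⊆ {ord J = μ}` (`μ ≥ 1`, `ord J ≤ μ`) and a near point `η′` over the generic point of `Y`, the
closure `Γ′ = cl{η′}` with its reduced structure is REGULAR, all its points are near, and `π(Γ′) = Y` ("`Γ′` is either empty
or a regular irreducible curve projecting isomorphically to `Y`").  Assembly of `CurveCentreNearPointGammaPrime`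
(clauses 2–3, reduction), `CurveCentreNearPointGammaPrimeQuotient` (quotient step) and
`IsBlowup.exists_isRsopPart_le_primeOfSpecializes_of_isNear_curve` (the pair `(π♯c_j, t − π♯a)`).
[cite: CossartPiltant2008, Lemma 4.3 (4)] -/
theorem IsBlowup.isRegular_gammaPrime_of_isNear_curve [IsLocallyNoetherian X]
    [IsLocallyNoetherian X'] (hX : Scheme.IsRegular X) {Y : Closeds X}
    (hYirr : IsIrreducible ((Y : Closeds X) : Set X))
    (hreg : Scheme.IsRegular (vanishingIdeal Y).subscheme) (hπ : IsBlowup π (vanishingIdeal Y))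
    {J : X.IdealSheafData} {μ : ℕ} (hμ : 1 ≤ μ) (hY : ∀ y ∈ (Y : Set X), idealOrder J y = μ)
    (hJ : ∀ x, idealOrder J x ≤ μ) {η' : X'} (hη' : closure {π η'} = (Y : Set X))
    (hcodim : Order.coheight (π η') = 2) (hnear : IsNear π (vanishingIdeal Y) J μ η') :
    Scheme.IsRegular (vanishingIdeal (⟨closure {η'}, isClosed_closure⟩ : Closeds X')).subscheme ∧
      (∀ z ∈ closure ({η'} : Set X'), IsNear π (vanishingIdeal Y) J μ z) ∧
      π '' closure ({η'} : Set X') = (Y : Set X) :=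
  hπ.isRegular_gammaPrime_of_forall_exists_isRsopPart hX hYirr hreg hμ hY hJ hη' hcodim hnear
    fun _ hz _ => hπ.exists_isRsopPart_le_primeOfSpecializes_of_isNear_curve hX hreg hμ hY hη' hcodim hnear hz

end Literature.AlgebraicGeometry.Resolution

end
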